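import Summits.ABC.StewartYu.PadicG3TwoSlabKStepOn
import HarnessLib

/-!
# Cell abc-stewartyu, WP-L.P(2) (crux r4 `PadicCoreTwoRat`, stmt-ABC-20504), layer K2: the Liouville half of
# the `2`-adic k-step with an ABSTRACT MONOMIAL-CLEARING DATUM, and the slab k-steps re-closed on it

`Summits/ABC/StewartYu/PadicG3TwoValuesGen.lean` — cell `abc-stewartyu` (HOME `run/shared/lean/pub/abc-stewartyu/`),
route `YuMatveevShapeRat`, seat p3 (g9, WP-L.P(2) lead; design memo HOME/p3/memo-11 §2 rows «values» / «k-step»;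
odd-`p` model = p2-g5's `PadicG3SatKStep`).  Theorems on the M2 datum `TwoSetup`; no definition, no named fact.

The landed Liouville step `PadicG3TwoValues.g3φ_eq_zero_of_norm_lt` clears the monomials `zmon(uᵢ, u_θᵢ, x) =
∏ₖ allₖ^{allExpₖ}` of a level family with the box denominator `monDen all (boxExp Dbox Dθ x)` of the COORDINATE
box `|uᵢⱼ| ≤ Dboxⱼ`, `|u_θᵢ| ≤ Dθ`.  In the 𝔑-threaded frame (generators `all = ϑ`, the squared saturated basis;
memo-11 (M1)) the family is a SKEW box in ϑ-coordinates and is cleared through its VIRTUAL `α`-coordinates instead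
(`SatCoords.exists_int_monDen_mul_prod_zpow_sat`: same shape, same numbers).  This file therefore re-states the
Liouville step and the slab k-steps with the clearing as an ABSTRACT per-point datum

  `Dm x ∈ ℕ`, `1 ≤ Dm x`, `Mm x ∈ ℤ`:  `Dm x · zmon(uᵢ, u_θᵢ, x) = z ∈ ℤ`, `|z| ≤ Mm x`  for every `i ∈ B`

(landed instance: `Dm = monDen all (boxExp Dbox Dθ x)`, `Mm = Dm²`; 𝔑-instance: `PadicTwoSatData`):

* `exists_int_clear_mul_coef_gen`, `exists_int_clear_mul_g3φ_gen`, **`g3φ_eq_zero_of_norm_lt_gen`**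
  (`K ≥ #B·P·M₀·Xb^{|t|}·Mm`) — proofs = the landed ones with the monomial line swapped;
* **`g3_slab_kstep_on_gen`**, **`g3_slab_kstep_Icc_gen`**, **`g3_slab_kstep_cop_gen`** — the slab k-steps of
  `PadicG3TwoSlabKStepOn` (node set `Z` / all nodes / nodes coprime to `3`) with the Liouville half on the datum;
  the extrapolation half is the landed `norm_g3G_le_of_zeros_on` UNMODIFIED.

WHAT THIS IS NOT: no instance of the datum, no level induction, no record; no crux moves (A1.L not moved).

References: K. Yu, Acta Math. 211 (2013), (5.35)–(5.41), Lemma 5.2, proof of Lemma 5.4; Yu. V. Nesterenko,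
LNM 1819 (2003) §3.2, Lemma 3.11, §4.3; HOME/p3/memo-11 §2.
-/

noncomputable section

open NormedSpace Finset IsUltrametricDist Polynomial
open Literature.NumberTheory.Transcendental
open Literature.NumberTheory.Transcendental.PadicCW77 (condExp)
open scoped Nat

namespace Summit.ABC.StewartYu

open Literature.NumberTheory.Transcendental.CW77.Setup (Tau tauNorm)
open G3Nodes

namespace TwoSetup

variable (S : TwoSetup) {ι : Type*} (R : ι → ℚ[X]) (u : ι → Fin S.d → ℤ) (uθ : ι → ℤ)

/-! ### The value cleared with an abstract monomial datum, and the Liouville inequality -/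

/-- **One coefficient cleared** (abstract monomial datum): if `Dm·zmon(uᵢ, u_θᵢ, x) = z₂ ∈ ℤ` with `|z₂| ≤ Mm`,
then `D·[(Hasse_{t₀} Rᵢ)(x)·∏ zγⱼ^{tⱼ}·zmonᵢ(x)] ∈ ℤ`, `|·| ≤ M₀·Xb^{|t|}·Mm`, `D = den₀·|b_θ|^{|t|}·Dm`.
[cite: Yu2013, (5.35); shape only] -/
theorem exists_int_clear_mul_coef_gen (i : ι) (τ : Tau S.d) (x : ℤ) {den₀ : ℕ} {M₀ : ℤ}
    (hR : ∃ z₀ : ℤ, (den₀ : ℚ) * (hasseDeriv τ.1 (R i)).eval (x : ℚ) = z₀ ∧ |z₀| ≤ M₀)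
    {Xb : ℤ} (hX : ∀ j, |S.dirScalar (u i) (uθ i) j| ≤ Xb) {Dm : ℕ} {Mm : ℤ}
    (hm : ∃ z₂ : ℤ, ((Dm : ℕ) : ℚ) * S.zmon (u i) (uθ i) x = z₂ ∧ |z₂| ≤ Mm) :
    ∃ z : ℤ, ((den₀ * S.bθ.natAbs ^ (∑ j, τ.2 j) * Dm : ℕ) : ℚ) *
        ((hasseDeriv τ.1 (R i)).eval (x : ℚ) * S.zγpow u uθ i τ.2 * S.zmon (u i) (uθ i) x) = z ∧
      |z| ≤ M₀ * Xb ^ (∑ j, τ.2 j) * Mm := by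
  -- the landed `PadicG3TwoValues.exists_int_clear_mul_coef` with the monomial line swapped
  obtain ⟨z₀, hz₀, hz₀le⟩ := hR
  obtain ⟨z₂, hz₂, hz₂le⟩ := hm
  set z₁ : ℤ := ∏ j, S.dirScalar (u i) (uθ i) j ^ τ.2 j with hz₁
  have hz₁q : ((S.bθ.natAbs ^ (∑ j, τ.2 j) : ℕ) : ℚ) * S.zγpow u uθ i τ.2 = (S.bθ.sign : ℚ) ^ (∑ j, τ.2 j) * z₁ := by
    have hsgn : ((S.bθ.natAbs : ℕ) : ℚ) = (S.bθ.sign : ℚ) * S.bθ := by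
      rw [Nat.cast_natAbs]; push_cast
      rw [← Int.cast_abs, ← Int.sign_mul_self_eq_abs]; push_cast; ring
    push_cast
    rw [hsgn, mul_pow, mul_assoc, S.bθ_pow_mul_zγpow, hz₁]
    push_cast; ring
  have hz₁le : |z₁| ≤ Xb ^ (∑ j, τ.2 j) := S.abs_prod_dirScalar_pow_le u uθ i τ.2 hX
  have hsgn1 : |(S.bθ.sign : ℤ) ^ (∑ j, τ.2 j)| = 1 := by
    rw [abs_pow]
    have : |S.bθ.sign| = 1 := by
      rcases lt_or_gt_of_ne S.bθ_ne with h | h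
      · rw [Int.sign_eq_neg_one_of_neg h]; rfl
      · rw [Int.sign_eq_one_of_pos h]; rfl
    rw [this, one_pow]
  refine ⟨z₀ * (S.bθ.sign ^ (∑ j, τ.2 j) * z₁) * z₂, ?_, ?_⟩
  · push_cast
    have e1 := hz₀
    have e2 := hz₁q
    have e3 := hz₂
    push_cast at e2 e3
    calc ((den₀ : ℚ) * ((S.bθ.natAbs : ℕ) : ℚ) ^ (∑ j, τ.2 j) * (Dm : ℚ)) *
          ((hasseDeriv τ.1 (R i)).eval (x : ℚ) * S.zγpow u uθ i τ.2 * S.zmon (u i) (uθ i) x)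
        = ((den₀ : ℚ) * (hasseDeriv τ.1 (R i)).eval (x : ℚ)) *
          ((((S.bθ.natAbs : ℕ) : ℚ) ^ (∑ j, τ.2 j)) * S.zγpow u uθ i τ.2) *
          ((Dm : ℚ) * S.zmon (u i) (uθ i) x) := by ring
      _ = (z₀ : ℚ) * ((S.bθ.sign : ℚ) ^ (∑ j, τ.2 j) * z₁) * z₂ := by rw [e1, e2, e3]
  · have h0 : (0 : ℤ) ≤ M₀ := (abs_nonneg _).trans hz₀le
    rw [abs_mul, abs_mul, abs_mul, hsgn1, one_mul]
    have hXb : (0 : ℤ) ≤ Xb ^ (∑ j, τ.2 j) := (abs_nonneg _).trans hz₁le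
    calc |z₀| * |z₁| * |z₂| ≤ M₀ * Xb ^ (∑ j, τ.2 j) * |z₂| := by
          refine mul_le_mul_of_nonneg_right ?_ (abs_nonneg _)
          exact mul_le_mul hz₀le hz₁le (abs_nonneg _) h0
      _ ≤ M₀ * Xb ^ (∑ j, τ.2 j) * Mm := mul_le_mul_of_nonneg_left hz₂le (mul_nonneg h0 hXb)

/-- **The value cleared** (abstract monomial datum): `D·φ_τ(x) ∈ ℤ`, `|·| ≤ #B·P·M₀·Xb^{|t|}·Mm`.
[cite: Yu2013, (5.35)–(5.39); shape only] -/
theorem exists_int_clear_mul_g3φ_gen (B : Finset ι) (p : ι → ℤ) (τ : Tau S.d) (x : ℤ) {den₀ : ℕ} {M₀ : ℤ}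
    (hR : ∀ i ∈ B, ∃ z₀ : ℤ, (den₀ : ℚ) * (hasseDeriv τ.1 (R i)).eval (x : ℚ) = z₀ ∧ |z₀| ≤ M₀)
    {Xb : ℤ} (hX : ∀ i ∈ B, ∀ j, |S.dirScalar (u i) (uθ i) j| ≤ Xb) {P : ℤ} (hP : ∀ i ∈ B, |p i| ≤ P)
    {Dm : ℕ} {Mm : ℤ} (hm : ∀ i ∈ B, ∃ z₂ : ℤ, ((Dm : ℕ) : ℚ) * S.zmon (u i) (uθ i) x = z₂ ∧ |z₂| ≤ Mm) :
    ∃ z : ℤ, ((den₀ * S.bθ.natAbs ^ (∑ j, τ.2 j) * Dm : ℕ) : ℚ) * S.g3φ R u uθ B p τ x = z ∧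
      |z| ≤ B.card * P * (M₀ * Xb ^ (∑ j, τ.2 j) * Mm) := by
  classical
  have hcoef : ∀ i ∈ B, ∃ z : ℤ, ((den₀ * S.bθ.natAbs ^ (∑ j, τ.2 j) * Dm : ℕ) : ℚ) *
        ((hasseDeriv τ.1 (R i)).eval (x : ℚ) * S.zγpow u uθ i τ.2 * S.zmon (u i) (uθ i) x) = z ∧
      |z| ≤ M₀ * Xb ^ (∑ j, τ.2 j) * Mm :=
    fun i hi => S.exists_int_clear_mul_coef_gen R u uθ i τ x (hR i hi) (hX i hi) (hm i hi)
  choose! z hz hzle using hcoef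
  refine ⟨∑ i ∈ B, p i * z i, ?_, ?_⟩
  · unfold g3φ
    rw [Finset.mul_sum]
    push_cast
    refine Finset.sum_congr rfl fun i hi => ?_
    have h := hz i hi
    push_cast at h
    calc ((den₀ : ℚ) * ((S.bθ.natAbs : ℕ) : ℚ) ^ (∑ j, τ.2 j) * (Dm : ℚ)) *
          ((p i : ℚ) * (hasseDeriv τ.1 (R i)).eval (x : ℚ) * S.zγpow u uθ i τ.2 * S.zmon (u i) (uθ i) x)
        = (p i : ℚ) * (((den₀ : ℚ) * ((S.bθ.natAbs : ℕ) : ℚ) ^ (∑ j, τ.2 j) * (Dm : ℚ)) *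
          ((hasseDeriv τ.1 (R i)).eval (x : ℚ) * S.zγpow u uθ i τ.2 * S.zmon (u i) (uθ i) x)) := by ring
      _ = (p i : ℚ) * (z i : ℚ) := by rw [h]
  · calc |∑ i ∈ B, p i * z i| ≤ ∑ i ∈ B, |p i * z i| := Finset.abs_sum_le_sum_abs _ _
      _ ≤ ∑ i ∈ B, P * (M₀ * Xb ^ (∑ j, τ.2 j) * Mm) := by
          refine Finset.sum_le_sum fun i hi => ?_
          rw [abs_mul]
          have hP0 : (0 : ℤ) ≤ P := (abs_nonneg _).trans (hP i hi)
          exact mul_le_mul (hP i hi) (hzle i hi) (abs_nonneg _) hP0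
      _ = B.card * P * (M₀ * Xb ^ (∑ j, τ.2 j) * Mm) := by
          rw [Finset.sum_const, nsmul_eq_mul]; ring

/-- **THE LIOUVILLE INEQUALITY AT THE INTEGER POINTS with an abstract monomial datum** (small ⇒ zero):
`‖φ_τ(x)‖₂ < 1/K` with `K ≥ #B·P·M₀·Xb^{|t|}·Mm` forces `φ_τ(x) = 0`. [cite: Yu2013, (5.40)–(5.41); shape only] -/
theorem g3φ_eq_zero_of_norm_lt_gen (B : Finset ι) (p : ι → ℤ) (τ : Tau S.d) (x : ℤ) {den₀ : ℕ}
    (hden₀ : 1 ≤ den₀) {M₀ : ℤ}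
    (hR : ∀ i ∈ B, ∃ z₀ : ℤ, (den₀ : ℚ) * (hasseDeriv τ.1 (R i)).eval (x : ℚ) = z₀ ∧ |z₀| ≤ M₀)
    {Xb : ℤ} (hX : ∀ i ∈ B, ∀ j, |S.dirScalar (u i) (uθ i) j| ≤ Xb) {P : ℤ} (hP : ∀ i ∈ B, |p i| ≤ P)
    {Dm : ℕ} (hDm : 1 ≤ Dm) {Mm : ℤ}
    (hm : ∀ i ∈ B, ∃ z₂ : ℤ, ((Dm : ℕ) : ℚ) * S.zmon (u i) (uθ i) x = z₂ ∧ |z₂| ≤ Mm)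
    {K : ℝ} (hK : (B.card : ℝ) * P * (M₀ * (Xb : ℝ) ^ (∑ j, τ.2 j) * Mm) ≤ K) (hK0 : 0 < K)
    (hlt : ‖((S.g3φ R u uθ B p τ x : ℚ) : ℚ_[2])‖ < 1 / K) :
    S.g3φ R u uθ B p τ x = 0 := by
  classical
  by_contra hne
  have hb1 : 1 ≤ S.bθ.natAbs := Int.natAbs_pos.mpr S.bθ_ne
  have hD1 : 1 ≤ den₀ * S.bθ.natAbs ^ (∑ j, τ.2 j) * Dm :=
    one_le_mul (one_le_mul hden₀ (Nat.one_le_pow _ _ hb1)) hDm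
  obtain ⟨z, hz, hzle⟩ := S.exists_int_clear_mul_g3φ_gen R u uθ B p τ x hR hX hP hm
  have hDpos : (0 : ℝ) < ((den₀ * S.bθ.natAbs ^ (∑ j, τ.2 j) * Dm : ℕ) : ℝ) := by
    exact_mod_cast (show 0 < den₀ * S.bθ.natAbs ^ (∑ j, τ.2 j) * Dm by omega)
  have hφ : |((S.g3φ R u uθ B p τ x : ℚ) : ℝ)| ≤ K / ((den₀ * S.bθ.natAbs ^ (∑ j, τ.2 j) * Dm : ℕ) : ℝ) := by
    rw [le_div_iff₀ hDpos]
    have h2 : (((den₀ * S.bθ.natAbs ^ (∑ j, τ.2 j) * Dm : ℕ) : ℝ)) *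
        ((S.g3φ R u uθ B p τ x : ℚ) : ℝ) = (z : ℝ) := by
      have := congrArg (fun q : ℚ => (q : ℝ)) hz
      push_cast at this ⊢
      exact this
    have h1 : |((S.g3φ R u uθ B p τ x : ℚ) : ℝ)| * (((den₀ * S.bθ.natAbs ^ (∑ j, τ.2 j) * Dm : ℕ) : ℝ)) =
        |(z : ℝ)| := by
      rw [← h2, abs_mul, Nat.abs_cast, mul_comm]
    rw [h1]
    have hzR : |(z : ℝ)| ≤ (B.card : ℝ) * P * (M₀ * (Xb : ℝ) ^ (∑ j, τ.2 j) * Mm) := by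
      have := (Int.cast_le (R := ℝ)).mpr hzle
      push_cast at this
      linarith
    exact hzR.trans hK
  have hge := SetupQ.padicNorm_ge_of_int_mul (p := 2) hne hD1 ⟨z, hz⟩ hφ
  have hKD : (((den₀ * S.bθ.natAbs ^ (∑ j, τ.2 j) * Dm : ℕ) : ℝ)) *
      (K / ((den₀ * S.bθ.natAbs ^ (∑ j, τ.2 j) * Dm : ℕ) : ℝ)) = K := by
    field_simp
  rw [hKD] at hge
  exact absurd hge (not_le.mpr hlt)

/-! ### The slab k-steps re-closed on the datum -/

/-- **The `2`-adic k-step ON THE SLAB from zeros at a node set `Z ⊆ [−N, N]`, Liouville half on an abstract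
monomial datum** `Dm x`, `Mm x` (per point, for every `i ∈ B`).  Extrapolation half = the landed
`norm_g3G_le_of_zeros_on`. [cite: Yu2013, Lemma 5.2 and proof of Lemma 5.4] -/
theorem g3_slab_kstep_on_gen (B : Finset ι) (p : ι → ℤ) (i₀ : ι) {m : ℕ}
    (hslab : ∀ i ∈ B, ‖S.δexpo u uθ i₀ i‖ ≤ ((2 : ℝ) ^ (m + 3))⁻¹) {N N' Tlo t : ℕ} (ht : 1 ≤ t)
    {Bw : ℝ} (hBw0 : 0 ≤ Bw) (hBw : ∀ i ∈ B, ∀ t₀ k, ‖(hw R i t₀).coeff k‖ * (4 * (2 : ℝ) ^ m) ^ k ≤ Bw)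
    (Z : Finset ℤ) (hZ : ∀ x ∈ Z, |x| ≤ (N : ℤ))
    (hzero : ∀ x ∈ Z, ∀ τ'' : Tau S.d, tauNorm τ'' < Tlo → S.g3φ R u uθ B p τ'' x = 0)
    (den₀ : ℤ → Tau S.d → ℕ) (hden₀ : ∀ x τ, 1 ≤ den₀ x τ) (M₀ : ℤ → Tau S.d → ℤ)
    (hR : ∀ (x : ℤ) (τ : Tau S.d), ∀ i ∈ B,
      ∃ z₀ : ℤ, (den₀ x τ : ℚ) * (hasseDeriv τ.1 (R i)).eval (x : ℚ) = z₀ ∧ |z₀| ≤ M₀ x τ)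
    {Xb : ℤ} (hX : ∀ i ∈ B, ∀ j, |S.dirScalar (u i) (uθ i) j| ≤ Xb) {P : ℤ} (hP : ∀ i ∈ B, |p i| ≤ P)
    (Dm : ℤ → ℕ) (hDm : ∀ x, 1 ≤ Dm x) (Mm : ℤ → ℤ)
    (hm : ∀ x : ℤ, ∀ i ∈ B, ∃ z₂ : ℤ, ((Dm x : ℕ) : ℚ) * S.zmon (u i) (uθ i) x = z₂ ∧ |z₂| ≤ Mm x)
    (K : ℤ → Tau S.d → ℝ) (hK0 : ∀ x τ, 0 < K x τ)
    (hK : ∀ (x : ℤ) (τ : Tau S.d), (B.card : ℝ) * P * (M₀ x τ * (Xb : ℝ) ^ (∑ j, τ.2 j) * Mm x) ≤ K x τ)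
    (hfinal : ∀ x₁ : ℤ, |x₁| ≤ (N' : ℤ) → ∀ τ : Tau S.d, tauNorm τ + t ≤ Tlo →
      max (Bw * ‖S.Λ₀‖ * (2 : ℝ) ^ t * (2 : ℝ) ^ condExp 2 (2 * N + 1) t)
        (Bw / (4 * (2 : ℝ) ^ m) ^ (Z.card * t)) < 1 / K x₁ τ) :
    ∀ x₁ : ℤ, |x₁| ≤ (N' : ℤ) → ∀ τ : Tau S.d, tauNorm τ + t ≤ Tlo →
      S.g3φ R u uθ B p τ x₁ = 0 := by
  intro x₁ hx₁ τ hτ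
  have hz : ‖((x₁ : ℤ) : ℚ_[2])‖ ≤ 1 := Padic.norm_int_le_one (p := 2) x₁
  have hcore := (S.norm_g3G_le_of_zeros_on R u uθ B p i₀ hslab ht hBw0 hBw Z hZ hzero hz τ hτ).2
  rw [S.g3Φ_intCast] at hcore
  exact S.g3φ_eq_zero_of_norm_lt_gen R u uθ B p τ x₁ (hden₀ x₁ τ) (hR x₁ τ) hX hP (hDm x₁) (hm x₁)
    (hK x₁ τ) (hK0 x₁ τ) (lt_of_le_of_lt hcore (hfinal x₁ hx₁ τ hτ))

/-- **The slab k-step from ALL the nodes `|x| ≤ N`** on an abstract monomial datum (exponent `(2N+1)·t`).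
[cite: Yu2013, Lemma 5.2] -/
theorem g3_slab_kstep_Icc_gen (B : Finset ι) (p : ι → ℤ) (i₀ : ι) {m : ℕ}
    (hslab : ∀ i ∈ B, ‖S.δexpo u uθ i₀ i‖ ≤ ((2 : ℝ) ^ (m + 3))⁻¹) {N N' Tlo t : ℕ} (ht : 1 ≤ t)
    {Bw : ℝ} (hBw0 : 0 ≤ Bw) (hBw : ∀ i ∈ B, ∀ t₀ k, ‖(hw R i t₀).coeff k‖ * (4 * (2 : ℝ) ^ m) ^ k ≤ Bw)
    (hzero : ∀ x : ℤ, |x| ≤ (N : ℤ) → ∀ τ'' : Tau S.d, tauNorm τ'' < Tlo → S.g3φ R u uθ B p τ'' x = 0)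
    (den₀ : ℤ → Tau S.d → ℕ) (hden₀ : ∀ x τ, 1 ≤ den₀ x τ) (M₀ : ℤ → Tau S.d → ℤ)
    (hR : ∀ (x : ℤ) (τ : Tau S.d), ∀ i ∈ B,
      ∃ z₀ : ℤ, (den₀ x τ : ℚ) * (hasseDeriv τ.1 (R i)).eval (x : ℚ) = z₀ ∧ |z₀| ≤ M₀ x τ)
    {Xb : ℤ} (hX : ∀ i ∈ B, ∀ j, |S.dirScalar (u i) (uθ i) j| ≤ Xb) {P : ℤ} (hP : ∀ i ∈ B, |p i| ≤ P)
    (Dm : ℤ → ℕ) (hDm : ∀ x, 1 ≤ Dm x) (Mm : ℤ → ℤ)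
    (hm : ∀ x : ℤ, ∀ i ∈ B, ∃ z₂ : ℤ, ((Dm x : ℕ) : ℚ) * S.zmon (u i) (uθ i) x = z₂ ∧ |z₂| ≤ Mm x)
    (K : ℤ → Tau S.d → ℝ) (hK0 : ∀ x τ, 0 < K x τ)
    (hK : ∀ (x : ℤ) (τ : Tau S.d), (B.card : ℝ) * P * (M₀ x τ * (Xb : ℝ) ^ (∑ j, τ.2 j) * Mm x) ≤ K x τ)
    (hfinal : ∀ x₁ : ℤ, |x₁| ≤ (N' : ℤ) → ∀ τ : Tau S.d, tauNorm τ + t ≤ Tlo →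
      max (Bw * ‖S.Λ₀‖ * (2 : ℝ) ^ t * (2 : ℝ) ^ condExp 2 (2 * N + 1) t)
        (Bw / (4 * (2 : ℝ) ^ m) ^ ((2 * N + 1) * t)) < 1 / K x₁ τ) :
    ∀ x₁ : ℤ, |x₁| ≤ (N' : ℤ) → ∀ τ : Tau S.d, tauNorm τ + t ≤ Tlo →
      S.g3φ R u uθ B p τ x₁ = 0 := by
  have hcard : (Finset.Icc (-(N : ℤ)) N).card = 2 * N + 1 := by rw [Int.card_Icc]; omega
  refine S.g3_slab_kstep_on_gen R u uθ B p i₀ hslab ht hBw0 hBw (Finset.Icc (-(N : ℤ)) N)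
    (fun x hx => abs_le_of_mem_Icc hx) (fun x hx τ'' hτ'' => hzero x (abs_le_of_mem_Icc hx) τ'' hτ'')
    den₀ hden₀ M₀ hR hX hP Dm hDm Mm hm K hK0 hK ?_
  rw [hcard]
  exact hfinal

/-- **The slab k-step from the nodes COPRIME TO `3`** on an abstract monomial datum (exponent
`2(N − ⌊N/3⌋)·t`). [cite: Yu2013, proof of Lemma 5.4] -/
theorem g3_slab_kstep_cop_gen (B : Finset ι) (p : ι → ℤ) (i₀ : ι) {m : ℕ}
    (hslab : ∀ i ∈ B, ‖S.δexpo u uθ i₀ i‖ ≤ ((2 : ℝ) ^ (m + 3))⁻¹) {N N' Tlo t : ℕ} (ht : 1 ≤ t)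
    {Bw : ℝ} (hBw0 : 0 ≤ Bw) (hBw : ∀ i ∈ B, ∀ t₀ k, ‖(hw R i t₀).coeff k‖ * (4 * (2 : ℝ) ^ m) ^ k ≤ Bw)
    (hzero : ∀ x : ℤ, |x| ≤ (N : ℤ) → ¬ (3 : ℤ) ∣ x → ∀ τ'' : Tau S.d, tauNorm τ'' < Tlo →
      S.g3φ R u uθ B p τ'' x = 0)
    (den₀ : ℤ → Tau S.d → ℕ) (hden₀ : ∀ x τ, 1 ≤ den₀ x τ) (M₀ : ℤ → Tau S.d → ℤ)
    (hR : ∀ (x : ℤ) (τ : Tau S.d), ∀ i ∈ B,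
      ∃ z₀ : ℤ, (den₀ x τ : ℚ) * (hasseDeriv τ.1 (R i)).eval (x : ℚ) = z₀ ∧ |z₀| ≤ M₀ x τ)
    {Xb : ℤ} (hX : ∀ i ∈ B, ∀ j, |S.dirScalar (u i) (uθ i) j| ≤ Xb) {P : ℤ} (hP : ∀ i ∈ B, |p i| ≤ P)
    (Dm : ℤ → ℕ) (hDm : ∀ x, 1 ≤ Dm x) (Mm : ℤ → ℤ)
    (hm : ∀ x : ℤ, ∀ i ∈ B, ∃ z₂ : ℤ, ((Dm x : ℕ) : ℚ) * S.zmon (u i) (uθ i) x = z₂ ∧ |z₂| ≤ Mm x)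
    (K : ℤ → Tau S.d → ℝ) (hK0 : ∀ x τ, 0 < K x τ)
    (hK : ∀ (x : ℤ) (τ : Tau S.d), (B.card : ℝ) * P * (M₀ x τ * (Xb : ℝ) ^ (∑ j, τ.2 j) * Mm x) ≤ K x τ)
    (hfinal : ∀ x₁ : ℤ, |x₁| ≤ (N' : ℤ) → ∀ τ : Tau S.d, tauNorm τ + t ≤ Tlo →
      max (Bw * ‖S.Λ₀‖ * (2 : ℝ) ^ t * (2 : ℝ) ^ condExp 2 (2 * N + 1) t)
        (Bw / (4 * (2 : ℝ) ^ m) ^ (2 * (N - N / 3) * t)) < 1 / K x₁ τ) :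
    ∀ x₁ : ℤ, |x₁| ≤ (N' : ℤ) → ∀ τ : Tau S.d, tauNorm τ + t ≤ Tlo →
      S.g3φ R u uθ B p τ x₁ = 0 := by
  classical
  set Z : Finset ℤ := (Finset.Icc (-(N : ℤ)) N).filter fun x => ¬ (3 : ℤ) ∣ x with hZdef
  have hcard : Z.card = 2 * (N - N / 3) := card_Icc_filter_not_three_dvd N
  have hZ : ∀ x ∈ Z, |x| ≤ (N : ℤ) := fun x hx =>
    abs_le_of_mem_Icc (Finset.mem_filter.mp hx).1
  refine S.g3_slab_kstep_on_gen R u uθ B p i₀ hslab ht hBw0 hBw Z hZ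
    (fun x hx τ'' hτ'' => hzero x (hZ x hx) (Finset.mem_filter.mp hx).2 τ'' hτ'')
    den₀ hden₀ M₀ hR hX hP Dm hDm Mm hm K hK0 hK ?_
  rw [hcard]
  exact hfinal

end TwoSetup

end Summit.ABC.StewartYu

end
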